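import Mathlib.Logic.Function.Basic
import Mathlib.Data.List.Basic
import Mathlib.Tactic.IntervalCases
import Mathlib.Tactic.Ring
import Mathlib.Tactic.Linarith
import HarnessLib

/-!
# The oblivious hierarchical stack (Hennie–Stearns zones for a pushdown store, fixed schedule)

Literature / complexity toolkit (serves the quasi-linear succinct Cook–Levin reduction behind
Williams' Fact 3.1, `SuccinctSkeletonReductions.lean`: the leaf `Williams2014_fact_3_1_skeleton`
needs an encoding of `2ⁿ`-time multi-stack computations by `2ⁿ · poly(n)` local constraints
whose dependency structure does not depend on the data). The classical device is the
**oblivious simulation** of Hennie–Stearns (1966) and Pippenger–Fischer (1979), used by Cook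
(1988) to represent time-`T` nondeterministic computations by formulas of size `O(T log T)`:
storage is split into zones of geometrically growing size which are kept "half full" by
transfers scheduled at FIXED times (zone `j` is touched only at multiples of `2ʲ`), so that
`T` operations cost `O(T log T)` symbol moves along a data-independent pattern.

This file formalizes the device for ONE STACK, as pure list combinatorics (no machine): the
data structure, the fixed schedule, and the invariant that makes every scheduled transfer
possible. The faithfulness of the representation (the represented word tracks the abstract
stack, the top symbol is read off level `0`) is the sibling `HierarchicalStackRepr.lean`.

* Levels `H : ℕ → List Γ` (level `j ≤ J` holds `d` BLOCKS of `2ʲ` symbols, top-most first;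
  levels `> J` are empty); the represented word is `H 0 ++ H 1 ++ ⋯ ++ H J` (top first).
* `fix dflt J j H` — the transfer at level `j`: if level `j` holds `≤ 2` blocks, BORROW the top
  block of level `j + 1` (two blocks of level `j`, appended below level `j`; level `J` borrows
  padding symbols `dflt` — the "junk" below the real content); if it holds `≥ 5` blocks, CARRY
  its bottom two blocks onto level `j + 1` (level `J` discards them); otherwise nothing.
* `fixes dflt J t` — the schedule at time `t`: `fix j` for `j = 0, 1, …, J` in this order, each
  only if `2ʲ ∣ t`; `step` = the fixes, then one stack operation (`Op.push/pop/nop`) on level `0`;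
  `run` iterates from an initial hierarchy (`init`: three blocks per level).
* **Invariant** (`Phase`, `Inv`, `inv_run`): level `j` always holds `d ∈ [3 - a, 3 + a]` blocks
  with an explicit allowance `a ≤ 3` depending on the phase `t mod 2ʲ` (`allow₀/₁/₂`): after its
  own fix `d ∈ [2, 4]`, and until the next one only the (at most one) intervening fix of level
  `j - 1` moves it, by one block. Consequences: every level holds at most `6` blocks
  (`length_run_le`), level `0` holds at least two symbols when the operation is applied
  (`two_le_length_fixes_run`), and every borrow below level `J` finds a full block
  (`Inv`-bounds of level `j + 1`).

## References

* F. C. Hennie, R. E. Stearns, *Two-tape simulation of multitape Turing machines*, J. ACM 13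
  (1966) 533–546, §3 "The simulation method" (storage areas of doubling size whose levels are
  "either completely full or completely empty", the order-`i` cleanups) [HennieStearns1966].
* N. Pippenger, M. J. Fischer, *Relations among complexity measures*, J. ACM 26 (1979)
  361–381, §3, Thm. 3 (the oblivious version: head movements, here transfers, on a fixed
  schedule) [PippengerFischer1979].
* S. A. Cook, *Short propositional formulas represent nondeterministic computations*,
  Inform. Process. Lett. 26 (1988) 269–270 (formulas of size `O(T log T)`) [Cook1988].
-/

namespace Literature.Computability.Complexity

namespace HStack

variable {Γ : Type}

/-! ### Padded prefixes -/

/-- `takePad dflt n l`: the first `n` symbols of `l`, padded with `dflt` to length exactly `n`.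
[folklore] -/
def takePad (dflt : Γ) (n : ℕ) (l : List Γ) : List Γ := (l ++ List.replicate n dflt).take n

/-- `takePad` as "take, then pad". [folklore] -/
theorem takePad_eq (dflt : Γ) (n : ℕ) (l : List Γ) :
    takePad dflt n l = l.take n ++ List.replicate (n - l.length) dflt := by
  simp [takePad, List.take_append, List.take_replicate]

/-- `takePad` has the prescribed length. [folklore] -/
@[simp] theorem length_takePad (dflt : Γ) (n : ℕ) (l : List Γ) :
    (takePad dflt n l).length = n := by
  rw [takePad_eq]
  simp only [List.length_append, List.length_take, List.length_replicate]
  omega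

/-- On a long enough list `takePad` is `take`. [folklore] -/
theorem takePad_of_le (dflt : Γ) {n : ℕ} {l : List Γ} (h : n ≤ l.length) :
    takePad dflt n l = l.take n := by
  rw [takePad_eq, Nat.sub_eq_zero_of_le h]
  simp

/-- Splitting a padded prefix. [folklore] -/
theorem takePad_add (dflt : Γ) (a b : ℕ) (l : List Γ) :
    takePad dflt (a + b) l = takePad dflt a l ++ takePad dflt b (l.drop a) := by
  rw [takePad_eq, takePad_eq, takePad_eq, List.take_add]
  simp only [List.length_drop, List.append_assoc]
  rcases le_or_gt a l.length with h | h
  · rw [Nat.sub_eq_zero_of_le h, show a + b - l.length = b - (l.length - a) by omega]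
    simp
  · have hd : l.drop a = [] := List.drop_of_length_le h.le
    rw [hd, show l.length - a = 0 by omega, show a + b - l.length = (a - l.length) + b by omega,
      List.replicate_add]
    simp

/-! ### Levels, transfers and the schedule -/

/-- BORROW at level `j`: the top block of level `j + 1` (`2 · 2ʲ` symbols, padded with `dflt`
if level `j + 1` is short — the junk supply of the last level) is appended below level `j`.
[cite: HennieStearns1966, §3] -/
def borrow (dflt : Γ) (j : ℕ) (H : ℕ → List Γ) : ℕ → List Γ :=
  Function.update (Function.update H j (H j ++ takePad dflt (2 * 2 ^ j) (H (j + 1)))) (j + 1)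
    ((H (j + 1)).drop (2 * 2 ^ j))

/-- CARRY at level `j`: the bottom two blocks of level `j` are put on top of level `j + 1`
(discarded at the last level `J`). [cite: HennieStearns1966, §3] -/
def carry (J j : ℕ) (H : ℕ → List Γ) : ℕ → List Γ :=
  if j < J then
    Function.update (Function.update H j ((H j).take ((H j).length - 2 * 2 ^ j))) (j + 1)
      ((H j).drop ((H j).length - 2 * 2 ^ j) ++ H (j + 1))
  else Function.update H j ((H j).take ((H j).length - 2 * 2 ^ j))

/-- The transfer at level `j`: borrow when level `j` holds at most two blocks, carry when it
holds at least five, nothing otherwise (the "half-full" normalisation of Hennie–Stearns).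
[cite: HennieStearns1966, §3] -/
def fix (dflt : Γ) (J j : ℕ) (H : ℕ → List Γ) : ℕ → List Γ :=
  if (H j).length ≤ 2 * 2 ^ j then borrow dflt j H
  else if 5 * 2 ^ j ≤ (H j).length then carry J j H
  else H

/-- The scheduled transfers of levels `0, …, n - 1` at time `t`, in increasing order, level `j`
only when `2ʲ ∣ t` (Pippenger–Fischer's fixed schedule). [cite: PippengerFischer1979, §3 (Thm. 3)] -/
def fixesBelow (dflt : Γ) (J t : ℕ) : ℕ → (ℕ → List Γ) → ℕ → List Γ
  | 0, H => H
  | n + 1, H => if 2 ^ n ∣ t then fix dflt J n (fixesBelow dflt J t n H)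
      else fixesBelow dflt J t n H

/-- All scheduled transfers at time `t` (levels `0, …, J`).
[cite: PippengerFischer1979, §3 (Thm. 3)] -/
def fixes (dflt : Γ) (J t : ℕ) (H : ℕ → List Γ) : ℕ → List Γ := fixesBelow dflt J t (J + 1) H

/-- Stack operations: push a symbol, pop, or nothing. [folklore] -/
inductive Op (Γ : Type) where
  | push (γ : Γ) : Op Γ
  | pop : Op Γ
  | nop : Op Γ

/-- The action of an operation on a word read as a stack, top first (`pop [] = []`).
[folklore] -/
def Op.onList : Op Γ → List Γ → List Γ
  | Op.push γ, S => γ :: S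
  | Op.pop, S => S.tail
  | Op.nop, S => S

/-- An operation lengthens a word by at most one symbol. [folklore] -/
theorem Op.length_onList_le (op : Op Γ) (S : List Γ) : (op.onList S).length ≤ S.length + 1 := by
  cases op with
  | push γ => simp [Op.onList]
  | pop => simp only [Op.onList, List.length_tail]; omega
  | nop => simp [Op.onList]

/-- Applying an operation to the hierarchy: it acts on level `0`. [folklore] -/
def applyOp (op : Op Γ) (H : ℕ → List Γ) : ℕ → List Γ := Function.update H 0 (op.onList (H 0))

/-- One time step: the scheduled transfers, then the operation.
[cite: PippengerFischer1979, §3 (Thm. 3)] -/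
def step (dflt : Γ) (J t : ℕ) (op : Op Γ) (H : ℕ → List Γ) : ℕ → List Γ :=
  applyOp op (fixes dflt J t H)

/-- The hierarchy after `t` steps of the operation sequence `ops`. [folklore] -/
def run (dflt : Γ) (J : ℕ) (ops : ℕ → Op Γ) (H₀ : ℕ → List Γ) : ℕ → ℕ → List Γ
  | 0 => H₀
  | t + 1 => step dflt J t (ops t) (run dflt J ops H₀ t)

/-- The abstract stack after `t` operations. [folklore] -/
def absRun (ops : ℕ → Op Γ) (S₀ : List Γ) : ℕ → List Γ
  | 0 => S₀
  | t + 1 => (ops t).onList (absRun ops S₀ t)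

/-- The initial hierarchy of a word `w`: level `j ≤ J` holds the three blocks of `w` (padded)
starting at position `3 (2ʲ - 1)`. [folklore] -/
def init (dflt : Γ) (J : ℕ) (w : List Γ) : ℕ → List Γ := fun j =>
  if j ≤ J then takePad dflt (3 * 2 ^ j) (w.drop (3 * (2 ^ j - 1))) else []

/-! ### Values of the transfers -/

/-- Level `j` after a borrow. [folklore] -/
@[simp] theorem borrow_self (dflt : Γ) (j : ℕ) (H : ℕ → List Γ) :
    borrow dflt j H j = H j ++ takePad dflt (2 * 2 ^ j) (H (j + 1)) := by
  simp [borrow]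

/-- Level `j + 1` after a borrow. [folklore] -/
@[simp] theorem borrow_succ (dflt : Γ) (j : ℕ) (H : ℕ → List Γ) :
    borrow dflt j H (j + 1) = (H (j + 1)).drop (2 * 2 ^ j) := by
  simp [borrow]

/-- The other levels after a borrow. [folklore] -/
theorem borrow_of_ne (dflt : Γ) {j k : ℕ} (H : ℕ → List Γ) (h₁ : k ≠ j) (h₂ : k ≠ j + 1) :
    borrow dflt j H k = H k := by
  simp [borrow, h₁, h₂]

/-- Level `j` after a carry. [folklore] -/
@[simp] theorem carry_self (J j : ℕ) (H : ℕ → List Γ) :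
    carry J j H j = (H j).take ((H j).length - 2 * 2 ^ j) := by
  unfold carry
  split_ifs <;> simp

/-- Level `j + 1` after a carry below the last level. [folklore] -/
theorem carry_succ_of_lt {J j : ℕ} (H : ℕ → List Γ) (h : j < J) :
    carry J j H (j + 1) = (H j).drop ((H j).length - 2 * 2 ^ j) ++ H (j + 1) := by
  simp [carry, h]

/-- Level `j + 1` after a carry at (or beyond) the last level is unchanged. [folklore] -/
theorem carry_succ_of_le {J j : ℕ} (H : ℕ → List Γ) (h : J ≤ j) :
    carry J j H (j + 1) = H (j + 1) := by
  simp [carry, Nat.not_lt.2 h]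

/-- The other levels after a carry. [folklore] -/
theorem carry_of_ne {J j k : ℕ} (H : ℕ → List Γ) (h₁ : k ≠ j) (h₂ : k ≠ j + 1) :
    carry J j H k = H k := by
  unfold carry
  split_ifs <;> simp [h₁, h₂]

/-- A transfer at level `j` changes only levels `j` and `j + 1`. [folklore] -/
theorem fix_of_ne (dflt : Γ) {J j k : ℕ} (H : ℕ → List Γ) (h₁ : k ≠ j) (h₂ : k ≠ j + 1) :
    fix dflt J j H k = H k := by
  unfold fix
  split_ifs
  · exact borrow_of_ne dflt H h₁ h₂
  · exact carry_of_ne H h₁ h₂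
  · rfl

/-- The transfers of levels `< n` do not touch the levels `≥ n + 1`. [folklore] -/
theorem fixesBelow_of_lt (dflt : Γ) (J t : ℕ) :
    ∀ (n : ℕ) (H : ℕ → List Γ) (k : ℕ), n < k → fixesBelow dflt J t n H k = H k
  | 0, _, _, _ => rfl
  | n + 1, H, k, hk => by
    have ih := fixesBelow_of_lt dflt J t n H k (Nat.lt_of_succ_lt hk)
    simp only [fixesBelow]
    split_ifs
    · rw [fix_of_ne dflt _ (by omega) (by omega), ih]
    · exact ih

/-! ### Arithmetic of the schedule -/

/-- The residue of `t + 1`. [folklore] -/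
theorem succ_mod_eq {P t : ℕ} (hP : 0 < P) :
    (t + 1) % P = if t % P + 1 = P then 0 else t % P + 1 := by
  have hlt : t % P < P := Nat.mod_lt t hP
  split_ifs with h
  · have : t + 1 = P * (t / P + 1) := by
      have := Nat.div_add_mod t P
      rw [Nat.mul_add, Nat.mul_one]; omega
    rw [this, Nat.mul_mod_right]
  · have h2 : t + 1 = P * (t / P) + (t % P + 1) := by
      have := Nat.div_add_mod t P; omega
    rw [h2, Nat.mul_add_mod, Nat.mod_eq_of_lt (by omega)]

/-- Divisibility by `h` read off the residue modulo `2h`. [folklore] -/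
theorem dvd_iff_mod_two_mul {h t : ℕ} (hh : 0 < h) :
    h ∣ t ↔ t % (2 * h) = 0 ∨ t % (2 * h) = h := by
  have key : t % h = t % (2 * h) % h := (Nat.mod_mod_of_dvd t (dvd_mul_left h 2)).symm
  have hr : t % (2 * h) < 2 * h := Nat.mod_lt t (by omega)
  rw [Nat.dvd_iff_mod_eq_zero, key]
  set r := t % (2 * h) with hr_def
  constructor
  · intro h0
    have hq : r / h < 2 := (Nat.div_lt_iff_lt_mul hh).2 (by simpa [Nat.mul_comm] using hr)
    have hre : r = h * (r / h) := by have := Nat.div_add_mod r h; omega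
    interval_cases hq' : r / h
    · left; simpa using hre
    · right; simpa using hre
  · rintro (h0 | h0)
    · simp [h0]
    · simp [h0]

/-- `2ʲ ∣ t` iff the residue modulo `2ʲ` vanishes. [folklore] -/
theorem two_pow_dvd_iff (j t : ℕ) : 2 ^ j ∣ t ↔ t % 2 ^ j = 0 := Nat.dvd_iff_mod_eq_zero

/-- For `1 ≤ j`: `2ʲ⁻¹ ∣ t` iff the residue modulo `2ʲ` is `0` or `2ʲ⁻¹`. [folklore] -/
theorem two_pow_pred_dvd_iff {j : ℕ} (hj : 1 ≤ j) (t : ℕ) :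
    2 ^ (j - 1) ∣ t ↔ t % 2 ^ j = 0 ∨ t % 2 ^ j = 2 ^ (j - 1) := by
  have h2 : 2 ^ j = 2 * 2 ^ (j - 1) := by
    rw [← Nat.pow_succ']; congr 1; omega
  rw [h2]
  exact dvd_iff_mod_two_mul (Nat.two_pow_pos _)

/-! ### The allowances of the invariant -/

/-- The phase slack `e ∈ {0, 1}` of level `j ≥ 1` at time `t`: `1` iff a transfer of level
`j - 1` has happened since the last transfer of level `j` (residue `0` with `t > 0`, or residue
`> 2ʲ⁻¹`). [folklore] -/
def slack (j t : ℕ) : ℕ := if (t % 2 ^ j = 0 ∧ 0 < t) ∨ 2 ^ (j - 1) < t % 2 ^ j then 1 else 0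

/-- Allowance of a level not yet touched at time `t`: `|d - 3| ≤ allow₀`. [folklore] -/
def allow₀ (j t : ℕ) : ℕ := if j = 0 then 2 else 1 + slack j t

/-- Allowance after the (possible) transfer of level `j - 1` at time `t`. [folklore] -/
def allow₁ (j t : ℕ) : ℕ := allow₀ j t + if 1 ≤ j ∧ 2 ^ (j - 1) ∣ t then 1 else 0

/-- Allowance after the (possible) transfer of level `j` itself at time `t`. [folklore] -/
def allow₂ (j t : ℕ) : ℕ := if 2 ^ j ∣ t then 1 else allow₁ j t

/-- Allowance of level `j` when the transfers of the levels `< n` have been done. [folklore] -/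
def allowAt (n j t : ℕ) : ℕ := if j < n then allow₂ j t else if j = n then allow₁ j t else allow₀ j t

/-- `slack ≤ 1`. [folklore] -/
theorem slack_le (j t : ℕ) : slack j t ≤ 1 := by unfold slack; split_ifs <;> omega

/-- `allow₀ ≤ 2`. [folklore] -/
theorem allow₀_le (j t : ℕ) : allow₀ j t ≤ 2 := by
  unfold allow₀; have := slack_le j t; split_ifs <;> omega

/-- `allow₀ ≤ allow₁`. [folklore] -/
theorem allow₀_le_allow₁ (j t : ℕ) : allow₀ j t ≤ allow₁ j t := by unfold allow₁; omega

/-- `allow₁ ≤ 3`. [folklore] -/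
theorem allow₁_le (j t : ℕ) : allow₁ j t ≤ 3 := by
  unfold allow₁ allow₀; have := slack_le j t; split_ifs <;> omega

/-- `allow₂ ≤ 3`. [folklore] -/
theorem allow₂_le (j t : ℕ) : allow₂ j t ≤ 3 := by
  unfold allow₂; have := allow₁_le j t; split_ifs <;> omega

/-- `allowAt ≤ 3`. [folklore] -/
theorem allowAt_le (n j t : ℕ) : allowAt n j t ≤ 3 := by
  unfold allowAt; have := allow₁_le j t; have := allow₂_le j t
  have := (allow₀_le j t).trans (by norm_num : 2 ≤ 3); split_ifs <;> omega

/-- Every untouched allowance is at least `1`. [folklore] -/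
theorem one_le_allow₀ (j t : ℕ) : 1 ≤ allow₀ j t := by unfold allow₀; split_ifs <;> omega

/-- **The phase step**: the allowance of level `j ≥ 1` after all transfers of time `t` is within
its untouched allowance at time `t + 1`. [folklore] -/
theorem allow₂_le_allow₀_succ {j : ℕ} (hj : 1 ≤ j) (t : ℕ) : allow₂ j t ≤ allow₀ j (t + 1) := by
  have hh : 1 ≤ 2 ^ (j - 1) := Nat.one_le_two_pow
  have h2 : 2 ^ j = 2 * 2 ^ (j - 1) := by rw [← Nat.pow_succ']; congr 1; omega
  have hr : t % 2 ^ j < 2 ^ j := Nat.mod_lt t (Nat.two_pow_pos j)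
  have hrt : t % 2 ^ j ≤ t := Nat.mod_le t _
  have hA : 2 ^ j ∣ t ↔ t % 2 ^ j = 0 := Nat.dvd_iff_mod_eq_zero
  have hB := two_pow_pred_dvd_iff hj t
  have hC := succ_mod_eq (t := t) (Nat.two_pow_pos j)
  have hj0 : j ≠ 0 := by omega
  simp only [allow₂, allow₁, allow₀, slack, hA, hB, hC, hj, hj0, true_and, if_false]
  generalize t % 2 ^ j = r at *
  generalize 2 ^ (j - 1) = h at *
  generalize 2 ^ j = P at *
  split_ifs <;> omega

/-! ### The invariant -/

/-- The invariant during the transfers of time `t`, after those of the levels `< n`: levels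
above `J` are empty, and level `j ≤ J` holds `d` whole blocks with `|d - 3| ≤ allowAt n j t`.
[cite: HennieStearns1966, §3] -/
structure Phase (J t n : ℕ) (H : ℕ → List Γ) : Prop where
  /-- Levels beyond the last one are empty. -/
  eq_nil : ∀ j, J < j → H j = []
  /-- Level `j` holds `d` whole blocks, `3 - allowance ≤ d ≤ 3 + allowance`. -/
  bounds : ∀ j, j ≤ J → ∃ d, (H j).length = d * 2 ^ j ∧ 3 ≤ d + allowAt n j t ∧
    d ≤ 3 + allowAt n j t

/-- The invariant of the hierarchy reached at time `t` (before its transfers).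
[cite: HennieStearns1966, §3] -/
def Inv (J t : ℕ) (H : ℕ → List Γ) : Prop := Phase J t 0 H

/-- The initial hierarchy satisfies the invariant (three blocks on every level). [folklore] -/
theorem inv_init (dflt : Γ) (J : ℕ) (w : List Γ) : Inv J 0 (init dflt J w) := by
  refine ⟨fun j hj => by simp [init, Nat.not_le.2 hj], fun j hj => ⟨3, ?_, by omega, by omega⟩⟩
  simp [init, hj]

/-- `allowAt` one level further, below the current level: unchanged. [folklore] -/
theorem allowAt_succ_of_lt {n j t : ℕ} (h : j < n) : allowAt (n + 1) j t = allowAt n j t := by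
  simp [allowAt, h, Nat.lt_succ_of_lt h]

/-- `allowAt` one level further, far above the current level: unchanged. [folklore] -/
theorem allowAt_succ_of_gt {n j t : ℕ} (h : n + 1 < j) : allowAt (n + 1) j t = allowAt n j t := by
  simp [allowAt, Nat.ne_of_gt h, Nat.ne_of_gt (Nat.lt_of_succ_lt h), Nat.not_lt.2 h.le,
    Nat.not_lt.2 (Nat.le_of_succ_le h.le)]

/-- `allowAt` at the current level, when its transfer is not scheduled: unchanged. [folklore] -/
theorem allowAt_succ_self_of_not_dvd {n t : ℕ} (h : ¬ 2 ^ n ∣ t) :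
    allowAt (n + 1) n t = allowAt n n t := by
  simp [allowAt, allow₂, h]

/-- `allowAt` at the current level, when its transfer is scheduled: `1`. [folklore] -/
theorem allowAt_succ_self_of_dvd {n t : ℕ} (h : 2 ^ n ∣ t) : allowAt (n + 1) n t = 1 := by
  simp [allowAt, allow₂, h]

/-- `allowAt` at the level above the current one, when the transfer is not scheduled:
unchanged. [folklore] -/
theorem allowAt_succ_succ_of_not_dvd {n t : ℕ} (h : ¬ 2 ^ n ∣ t) :
    allowAt (n + 1) (n + 1) t = allowAt n (n + 1) t := by
  simp [allowAt, allow₁, h]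

/-- `allowAt` at the level above the current one, when the transfer is scheduled: one more.
[folklore] -/
theorem allowAt_succ_succ_of_dvd {n t : ℕ} (h : 2 ^ n ∣ t) :
    allowAt (n + 1) (n + 1) t = allowAt n (n + 1) t + 1 := by
  simp [allowAt, allow₁, h]

/-- **One scheduled transfer preserves the invariant.** [cite: HennieStearns1966, §3] -/
theorem Phase.succ (dflt : Γ) {J t n : ℕ} {H : ℕ → List Γ} (hP : Phase J t n H) (hn : n ≤ J) :
    Phase J t (n + 1) (if 2 ^ n ∣ t then fix dflt J n H else H) := by
  by_cases hdvd : 2 ^ n ∣ t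
  · rw [if_pos hdvd]
    have hpos : 0 < 2 ^ n := Nat.two_pow_pos n
    obtain ⟨d, hd, hlo, hhi⟩ := hP.bounds n hn
    have hself : allowAt n n t = allow₁ n t := by simp [allowAt]
    rw [hself] at hlo hhi
    have ha1 := allow₁_le n t
    -- the three regimes of `fix`, read on `d`
    have hlen_le : ((H n).length ≤ 2 * 2 ^ n) ↔ d ≤ 2 := by
      rw [hd]
      exact ⟨fun h' => Nat.le_of_mul_le_mul_right h' hpos, fun h' => Nat.mul_le_mul_right _ h'⟩
    have hlen_ge : (5 * 2 ^ n ≤ (H n).length) ↔ 5 ≤ d := by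
      rw [hd]
      exact ⟨fun h' => Nat.le_of_mul_le_mul_right h' hpos, fun h' => Nat.mul_le_mul_right _ h'⟩
    -- level `n + 1` before the transfer
    have hup : n < J → ∃ d', (H (n + 1)).length = d' * 2 ^ (n + 1) ∧
        3 ≤ d' + allowAt n (n + 1) t ∧ d' ≤ 3 + allowAt n (n + 1) t ∧ 1 ≤ d' := by
      intro hnJ
      obtain ⟨d', hd', hlo', hhi'⟩ := hP.bounds (n + 1) hnJ
      have ha0 : allowAt n (n + 1) t = allow₀ (n + 1) t := by simp [allowAt]
      have := allow₀_le (n + 1) t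
      exact ⟨d', hd', hlo', hhi', by rw [ha0] at hlo'; omega⟩
    refine ⟨fun j hj => ?_, fun j hj => ?_⟩
    · -- emptiness beyond `J`
      unfold fix
      split_ifs with h1 h2
      · by_cases hj1 : j = n + 1
        · subst hj1; rw [borrow_succ, hP.eq_nil _ hj]; exact List.drop_nil
        · rw [borrow_of_ne dflt _ (by omega) hj1, hP.eq_nil _ hj]
      · by_cases hj1 : j = n + 1
        · subst hj1; rw [carry_succ_of_le _ (by omega), hP.eq_nil _ hj]
        · rw [carry_of_ne _ (by omega) hj1, hP.eq_nil _ hj]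
      · exact hP.eq_nil _ hj
    · -- the bounds
      rcases Nat.lt_trichotomy j n with hjn | rfl | hjn
      · -- below the current level: untouched
        obtain ⟨e, he, hlo', hhi'⟩ := hP.bounds j hj
        refine ⟨e, ?_, by rw [allowAt_succ_of_lt hjn]; exact hlo',
          by rw [allowAt_succ_of_lt hjn]; exact hhi'⟩
        rw [fix_of_ne dflt _ (Nat.ne_of_lt hjn) (by omega), he]
      · -- the current level: normalised to `[2, 4]`
        rw [allowAt_succ_self_of_dvd hdvd]
        unfold fix
        split_ifs with h1 h2
        · refine ⟨d + 2, ?_, by omega, by rw [hlen_le] at h1; omega⟩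
          rw [borrow_self, List.length_append, length_takePad, hd]; ring
        · refine ⟨d - 2, ?_, by rw [hlen_ge] at h2; omega, by omega⟩
          rw [carry_self, List.length_take, hd, Nat.min_eq_left (Nat.sub_le _ _)]
          rw [hlen_ge] at h2
          rw [Nat.sub_mul, show 2 * 2 ^ j = 2 * 2 ^ j from rfl]
        · rw [hlen_le] at h1; rw [hlen_ge] at h2
          exact ⟨d, hd, by omega, by omega⟩
      · rcases Nat.lt_or_ge (n + 1) j with hjn' | hjn'
        · -- far above: untouched
          obtain ⟨e, he, hlo', hhi'⟩ := hP.bounds j hj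
          refine ⟨e, ?_, by rw [allowAt_succ_of_gt hjn']; exact hlo',
            by rw [allowAt_succ_of_gt hjn']; exact hhi'⟩
          rw [fix_of_ne dflt _ (by omega) (by omega), he]
        · -- the level just above: moved by one block
          obtain rfl : j = n + 1 := le_antisymm hjn' hjn
          obtain ⟨d', hd', hlo', hhi', h1d'⟩ := hup (Nat.lt_of_succ_le hj)
          rw [allowAt_succ_succ_of_dvd hdvd]
          have hnJ : n < J := Nat.lt_of_succ_le hj
          unfold fix
          split_ifs with h1 h2
          · refine ⟨d' - 1, ?_, by omega, by omega⟩
            rw [borrow_succ, List.length_drop, hd', pow_succ]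
            have : 2 ^ n * 2 ≤ d' * (2 ^ n * 2) := Nat.le_mul_of_pos_left _ h1d'
            rw [show 2 * 2 ^ n = 2 ^ n * 2 by ring, Nat.sub_mul]; ring_nf
          · refine ⟨d' + 1, ?_, by omega, by omega⟩
            rw [carry_succ_of_lt _ hnJ, List.length_append, List.length_drop, hd', hd]
            rw [hlen_ge] at h2
            have : 2 * 2 ^ n ≤ d * 2 ^ n := by nlinarith
            rw [Nat.sub_sub_self this, pow_succ]; ring
          · exact ⟨d', hd', by omega, by omega⟩
  · rw [if_neg hdvd]
    refine ⟨hP.eq_nil, fun j hj => ?_⟩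
    obtain ⟨d, hd, hlo, hhi⟩ := hP.bounds j hj
    refine ⟨d, hd, ?_, ?_⟩ <;>
    · rcases Nat.lt_trichotomy j n with hjn | rfl | hjn
      · rwa [allowAt_succ_of_lt hjn]
      · rwa [allowAt_succ_self_of_not_dvd hdvd]
      · rcases Nat.lt_or_ge (n + 1) j with hjn' | hjn'
        · rwa [allowAt_succ_of_gt hjn']
        · obtain rfl : j = n + 1 := le_antisymm hjn' hjn
          rwa [allowAt_succ_succ_of_not_dvd hdvd]

/-- The scheduled transfers of the levels `< n` preserve the invariant.
[cite: HennieStearns1966, §3] -/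
theorem Phase.fixesBelow (dflt : Γ) {J t : ℕ} {H : ℕ → List Γ} (hP : Phase J t 0 H) :
    ∀ n, n ≤ J + 1 → Phase J t n (fixesBelow dflt J t n H)
  | 0, _ => hP
  | n + 1, hn => by
    have ih := Phase.fixesBelow dflt hP n (Nat.le_of_succ_le hn)
    simpa [HStack.fixesBelow] using ih.succ dflt (Nat.le_of_lt_succ hn)

/-- **The operation closes the time step**: after all transfers of time `t` and one operation
on level `0`, the invariant holds at time `t + 1`. [cite: HennieStearns1966, §3] -/
theorem Phase.applyOp {J t : ℕ} {H : ℕ → List Γ} (hP : Phase J t (J + 1) H) (op : Op Γ) :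
    Inv J (t + 1) (applyOp op H) := by
  refine ⟨fun j hj => ?_, fun j hj => ?_⟩
  · rw [HStack.applyOp, Function.update_of_ne (by omega), hP.eq_nil _ hj]
  · obtain ⟨d, hd, hlo, hhi⟩ := hP.bounds j hj
    have hlt : allowAt (J + 1) j t = allow₂ j t := by simp [allowAt, Nat.lt_succ_of_le hj]
    rw [hlt] at hlo hhi
    rcases Nat.eq_zero_or_pos j with rfl | hj0
    · -- level `0`: `d ∈ [2, 4]`, then `± 1`
      have h2 : allow₂ 0 t = 1 := by simp [allow₂]
      rw [h2] at hlo hhi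
      have ha : allowAt 0 0 (t + 1) = 2 := by simp [allowAt, allow₁, allow₀]
      rw [ha]
      simp only [pow_zero, mul_one] at hd ⊢
      rw [HStack.applyOp, Function.update_self]
      cases op with
      | push γ => exact ⟨d + 1, by simp [Op.onList, hd], by omega, by omega⟩
      | pop => exact ⟨d - 1, by simp [Op.onList, hd], by omega, by omega⟩
      | nop => exact ⟨d, by simp [Op.onList, hd], by omega, by omega⟩
    · -- higher levels: untouched, allowance carried to `t + 1`
      have ha : allowAt 0 j (t + 1) = allow₀ j (t + 1) := by
        simp [allowAt, Nat.ne_of_gt hj0]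
      have hstep := allow₂_le_allow₀_succ hj0 t
      refine ⟨d, ?_, by rw [ha]; omega, by rw [ha]; omega⟩
      rw [HStack.applyOp, Function.update_of_ne (Nat.ne_of_gt hj0), hd]

/-- **One time step preserves the invariant.** [cite: HennieStearns1966, §3] -/
theorem Inv.step (dflt : Γ) {J t : ℕ} {H : ℕ → List Γ} (h : Inv J t H) (op : Op Γ) :
    Inv J (t + 1) (step dflt J t op H) :=
  (Phase.fixesBelow dflt h (J + 1) le_rfl).applyOp op

/-- **The invariant holds along every run** from the initial hierarchy of any word.
[cite: HennieStearns1966, §3] -/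
theorem inv_run (dflt : Γ) (J : ℕ) (ops : ℕ → Op Γ) (w : List Γ) :
    ∀ t, Inv J t (run dflt J ops (init dflt J w) t)
  | 0 => inv_init dflt J w
  | t + 1 => (inv_run dflt J ops w t).step dflt (ops t)

/-- **Capacity**: every level holds at most six blocks, at all times. [folklore] -/
theorem length_run_le (dflt : Γ) (J : ℕ) (ops : ℕ → Op Γ) (w : List Γ) (t j : ℕ) :
    (run dflt J ops (init dflt J w) t j).length ≤ 6 * 2 ^ j := by
  have h := inv_run dflt J ops w t
  rcases Nat.lt_or_ge J j with hj | hj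
  · rw [h.eq_nil j hj]; simp
  · obtain ⟨d, hd, -, hhi⟩ := h.bounds j hj
    have := allowAt_le 0 j t
    rw [hd]
    exact Nat.mul_le_mul_right _ (by omega)

/-- Capacity during the transfers: after the transfers of the levels `< n` at time `t`, every
level still holds at most six blocks. [folklore] -/
theorem length_fixesBelow_run_le (dflt : Γ) (J : ℕ) (ops : ℕ → Op Γ) (w : List Γ) (t j n : ℕ)
    (hn : n ≤ J + 1) :
    (fixesBelow dflt J t n (run dflt J ops (init dflt J w) t) j).length ≤ 6 * 2 ^ j := by
  have h := (inv_run dflt J ops w t).fixesBelow dflt n hn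
  rcases Nat.lt_or_ge J j with hj | hj
  · rw [h.eq_nil j hj]; simp
  · obtain ⟨d, hd, -, hhi⟩ := h.bounds j hj
    have := allowAt_le n j t
    rw [hd]
    exact Nat.mul_le_mul_right _ (by omega)

/-- **Level `0` is never short**: when the operation of time `t` is applied, level `0` holds at
least two symbols (so a pop always finds a symbol, junk or not). [folklore] -/
theorem two_le_length_fixes_run (dflt : Γ) (J : ℕ) (ops : ℕ → Op Γ) (w : List Γ) (t : ℕ) :
    2 ≤ (fixes dflt J t (run dflt J ops (init dflt J w) t) 0).length := by
  have h := (inv_run dflt J ops w t).fixesBelow dflt (J + 1) le_rfl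
  obtain ⟨d, hd, hlo, -⟩ := h.bounds 0 (Nat.zero_le J)
  have ha : allowAt (J + 1) 0 t = 1 := by simp [allowAt, allow₂]
  rw [fixes, hd]
  simp only [pow_zero, mul_one]
  omega

/-- **Every borrow below the last level finds a full block**: when the transfer of level
`j < J` is executed at time `t`, level `j + 1` holds at least one block. [folklore] -/
theorem two_pow_le_length_succ (dflt : Γ) (J : ℕ) (ops : ℕ → Op Γ) (w : List Γ) {t j : ℕ}
    (hj : j < J) :
    2 * 2 ^ j ≤ (fixesBelow dflt J t j (run dflt J ops (init dflt J w) t) (j + 1)).length := by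
  have h := (inv_run dflt J ops w t).fixesBelow dflt j (by omega)
  obtain ⟨d, hd, hlo, -⟩ := h.bounds (j + 1) hj
  have ha : allowAt j (j + 1) t = allow₀ (j + 1) t := by simp [allowAt]
  have := allow₀_le (j + 1) t
  rw [hd, pow_succ]
  have h1 : 1 ≤ d := by rw [ha] at hlo; omega
  calc 2 * 2 ^ j = 1 * (2 ^ j * 2) := by ring
    _ ≤ d * (2 ^ j * 2) := Nat.mul_le_mul_right _ h1

end HStack

end Literature.Computability.Complexity
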